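import Summits.RiemannHypothesis.RiemannHypothesis.Theorems.MotivicDoorArchLogLaplacian
import HarnessLib

/-!
# The archimedean Weil term is half a log-Laplacian energy up to an `L¹`-bounded error

HONEST FRAMING (cell pub-rhdoor, verbatim): lottery ticket at the motivic door; RH probability
negligible; consolation prizes are real: a new semi-local Weil-positivity theorem, or a located
gap in the Connes–Consani programme, plus the ff-door theorem.

PROVED here (a corollary of `weilArchTermBombieri_eq_logLaplacian`, same namespace): for every
Weil test function `F`, with `k = weilSymm F`,

  `‖weilArchTermBombieri F − ½·logLaplacianEnergy F + log(2π)·F 0‖ ≤ (5/2)·∫_{(0,∞)} ‖k‖`,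

i.e. the archimedean term differs from one half of the log-Laplacian energy (Fourier symbol
`log |τ|`) minus `log(2π)·F(0)` by a term controlled by the `L¹` norm of the symmetrisation —
the quantitative form of "`−W_ℝ = ½ L_Δ + bounded`" used by the window-operator reading in the
cell's EXTREMISERS.md §3.8 (the constant `5/2` comes from the crude bound `|k_r| ≤ 5` of
`abs_archResidualKernel_le`; the true supremum of `|k_r|` is `1/2`, not proved here).
Nothing in this file is a statement about `ζ`; no number in this file is DATA.
-/

noncomputable section

set_option linter.dupNamespace false

open Complex Filter Set MeasureTheory
open scoped Real Topology

namespace Summit.RiemannHypothesis.RiemannHypothesis.Theorems.MotivicDoor.ArchLogLaplacian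

open Literature.NumberTheory.LFunctions

/-- The residual term of `weilArchTermBombieri_eq_logLaplacian` is bounded by
`(5/2)·‖weilSymm F‖_{L¹(0,∞)}`. -/
theorem norm_archResidual_le {F : ℝ → ℂ} (hF : IsWeilTest F) :
    ‖(1 / 2 : ℂ) * ∫ x in Ioi (0 : ℝ), (archResidualKernel x : ℂ) * weilSymm F x‖ ≤
      (5 / 2) * ∫ x in Ioi (0 : ℝ), ‖weilSymm F x‖ := by
  have hk : IsWeilTest (weilSymm F) := hF.weilSymm
  have hint : IntegrableOn (fun x => weilSymm F x) (Ioi (0 : ℝ)) :=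
    (hk.1.continuous.integrable_of_hasCompactSupport hk.2).integrableOn
  have h2 : ‖∫ x in Ioi (0 : ℝ), (archResidualKernel x : ℂ) * weilSymm F x‖ ≤
      ∫ x in Ioi (0 : ℝ), 5 * ‖weilSymm F x‖ := by
    refine (norm_integral_le_integral_norm _).trans ?_
    refine setIntegral_mono_on (integrableOn_archResidualKernel_mul hk).norm
      (hint.norm.const_mul 5) measurableSet_Ioi ?_
    intro x hx
    rw [norm_mul, Complex.norm_real, Real.norm_eq_abs]
    exact mul_le_mul_of_nonneg_right (abs_archResidualKernel_le hx) (norm_nonneg _)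
  rw [integral_const_mul] at h2
  rw [norm_mul]
  have h1 : ‖(1 / 2 : ℂ)‖ = 1 / 2 := by simp
  rw [h1]
  linarith

/-- Quantitative "½ log-Laplacian + bounded": the archimedean Weil term in Bombieri's form
differs from `½·logLaplacianEnergy F − log(2π)·F 0` by at most `(5/2)·∫_{(0,∞)} ‖weilSymm F‖`. -/
theorem norm_weilArchTermBombieri_sub_logLaplacian_le {F : ℝ → ℂ} (hF : IsWeilTest F) :
    ‖weilArchTermBombieri F -
        ((1 / 2 : ℂ) * logLaplacianEnergy F - (Real.log (2 * π) : ℂ) * F 0)‖ ≤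
      (5 / 2) * ∫ x in Ioi (0 : ℝ), ‖weilSymm F x‖ := by
  rw [weilArchTermBombieri_eq_logLaplacian hF, add_sub_cancel_left]
  exact norm_archResidual_le hF

end Summit.RiemannHypothesis.RiemannHypothesis.Theorems.MotivicDoor.ArchLogLaplacian
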